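import Mathlib
import HarnessLib
import Literature.NumberTheory.DiophantineGeometry.ConicParametrisationAlgebra
import Literature.NumberTheory.DiophantineGeometry.ConicChartLocal

/-!
# Local densities of the primitive points of a diagonal conic, I: packages, transfers, weights

Continues `ConicParametrisationAlgebra.lean` and `ConicChartLocal.lean` (Browning–Van Valckenborgh
2012, §2.2 Lemmas 1–2 and §3, by the classical parametrisation). For the conic `aX² + bY² = cZ²`
(`abc` square-free) with a primitive zero `P = (α,β,γ)` and a unimodular completion
`det(P,e₁,e₂) = 1`, the primitive points are `x(v)/g(v)`, `x(v) = conicMap (a,b,−c) P (v₁e₁+v₂e₂)`,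
`g = ` content, `v ∈ ℤ²` primitive. This file builds the `p`-adic bookkeeping of `g(v)` and of
the integrality conditions `a ∣ X, b ∣ Y, c ∣ Z` as functions of `v mod p²`:

* generic-ring determinant `det3R` and `comb_eq_zero_cast3` (coordinates are unique modulo `n`);
  `conicMap` is equivariant under the coordinate swaps `swap01`, `swap02` and respects
  congruences (`conicMap_modEq`); the **chart reductions** `chart2_reduction`, `chart0_reduction`
  (`conicMap A P u ≡ conicMap A P (s',t',0)` modulo `n` when `γ` resp. `α` is a unit mod `n`);
* the **standard local packages**: weights `wOdd` (odd `p ∥ A₀`), `wTwoA` (`2 ∥ A₀`), `wTwoB`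
  (`A₀A₁A₂` odd) on `(ℤ/p²)²`, their meaning for the content and the conditions
  (`wOdd_facts`, `wTwoA_facts`, `wTwoB_facts`) and their sums `2p²(p−1)`, `16`, `16`
  (`sum_wOdd`, `sum_wTwoA`, `sum_wTwoB`) — these are the densities `(1−1/p)(1+χ)` and `σ₂` of
  Lemmas 1–2 of the paper, reached through the parametrisation;
* the **chart transfers** `transfer2`, `transfer0` on `(ℤ/n)²` (linear bijections, compatible with
  the integer chart reductions, preserving primitivity);
* `localWeight a b c P e₁ e₂ p` — the local weight at `p` in the original coordinates — with its
  values, the unit lemmas `units_of_dvd_fst`, `units_of_dvd_thd`, `parities_of_odd`, and the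
  meaning of the weight at a prime `p ∣ a` (`localWeight_facts_a`).

Everything is proved; the definitions are plain (finite) bookkeeping functions.

## References

* T. D. Browning, K. Van Valckenborgh, *Sums of three squareful numbers*, Exp. Math. 21 (2012)
  204–211, §2.2 Lemmas 1–2, §3. [cite: BrowningValckenborgh2012, §2.2, §3]
-/

namespace Literature.NumberTheory.DiophantineGeometry


/-! ## Generic `3 × 3` determinant over a commutative ring -/

section DetR

variable {R : Type*} [CommRing R]

/-- The `3 × 3` determinant with rows `u, v, w` over a commutative ring. [folklore] -/
def det3R (u v w : R × R × R) : R :=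
  u.1 * (v.2.1 * w.2.2 - v.2.2 * w.2.1) - u.2.1 * (v.1 * w.2.2 - v.2.2 * w.1) +
    u.2.2 * (v.1 * w.2.1 - v.2.1 * w.1)

/-- `det(kP + se₁ + te₂, e₁, e₂) = k det(P,e₁,e₂)`. [folklore] -/
theorem det3R_comb_fst (P e₁ e₂ : R × R × R) (k s t : R) :
    det3R (k • P + s • e₁ + t • e₂) e₁ e₂ = k * det3R P e₁ e₂ := by
  simp only [det3R, Prod.smul_fst, Prod.smul_snd, Prod.fst_add, Prod.snd_add, smul_eq_mul]; ring

/-- `det(P, kP + se₁ + te₂, e₂) = s det(P,e₁,e₂)`. [folklore] -/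
theorem det3R_comb_snd (P e₁ e₂ : R × R × R) (k s t : R) :
    det3R P (k • P + s • e₁ + t • e₂) e₂ = s * det3R P e₁ e₂ := by
  simp only [det3R, Prod.smul_fst, Prod.smul_snd, Prod.fst_add, Prod.snd_add, smul_eq_mul]; ring

/-- `det(P, e₁, kP + se₁ + te₂) = t det(P,e₁,e₂)`. [folklore] -/
theorem det3R_comb_thd (P e₁ e₂ : R × R × R) (k s t : R) :
    det3R P e₁ (k • P + s • e₁ + t • e₂) = t * det3R P e₁ e₂ := by
  simp only [det3R, Prod.smul_fst, Prod.smul_snd, Prod.fst_add, Prod.snd_add, smul_eq_mul]; ring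

/-- The cast of an integer vector to `R³`. [folklore] -/
def cast3 (x : ℤ × ℤ × ℤ) : R × R × R := ((x.1 : R), (x.2.1 : R), (x.2.2 : R))

omit [CommRing R] in
/-- Components of `cast3`. [folklore] -/
theorem cast3_apply [CommRing R] (x : ℤ × ℤ × ℤ) :
    (cast3 x : R × R × R) = ((x.1 : R), (x.2.1 : R), (x.2.2 : R)) := rfl

/-- `det3R` of casts is the cast of `idet3`. [folklore] -/
theorem det3R_cast3 (u v w : ℤ × ℤ × ℤ) :
    det3R (cast3 u : R × R × R) (cast3 v) (cast3 w) = ((idet3 u v w : ℤ) : R) := by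
  simp only [det3R, cast3, idet3]; push_cast; ring

/-- **Unique coordinates modulo `n`** (indeed over any ring): if `det(P,e₁,e₂) = 1` in `ℤ`, then
`k • P + s • e₁ + t • e₂ = 0` in `R³` forces `k = s = t = 0`. [folklore] -/
theorem comb_eq_zero_cast3 {P e₁ e₂ : ℤ × ℤ × ℤ} (he : idet3 P e₁ e₂ = 1) {k s t : R}
    (h : k • (cast3 P : R × R × R) + s • cast3 e₁ + t • cast3 e₂ = 0) :
    k = 0 ∧ s = 0 ∧ t = 0 := by
  have hd : det3R (cast3 P : R × R × R) (cast3 e₁) (cast3 e₂) = 1 := by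
    rw [det3R_cast3, he, Int.cast_one]
  refine ⟨?_, ?_, ?_⟩
  · have := det3R_comb_fst (cast3 P : R × R × R) (cast3 e₁) (cast3 e₂) k s t
    rw [h, hd, mul_one] at this
    rw [← this]; simp [det3R]
  · have := det3R_comb_snd (cast3 P : R × R × R) (cast3 e₁) (cast3 e₂) k s t
    rw [h, hd, mul_one] at this
    rw [← this]; simp [det3R]
  · have := det3R_comb_thd (cast3 P : R × R × R) (cast3 e₁) (cast3 e₂) k s t
    rw [h, hd, mul_one] at this
    rw [← this]; simp [det3R]

end DetR

/-! ## Symmetries and congruences of `conicMap` -/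

/-- Swapping the first two coordinates. [folklore] -/
def swap01 (x : ℤ × ℤ × ℤ) : ℤ × ℤ × ℤ := (x.2.1, x.1, x.2.2)

/-- Swapping the first and last coordinates. [folklore] -/
def swap02 (x : ℤ × ℤ × ℤ) : ℤ × ℤ × ℤ := (x.2.2, x.2.1, x.1)

/-- `conicMap` is equivariant under swapping coordinates `0, 1`. [folklore] -/
theorem conicMap_swap01 (A P u : ℤ × ℤ × ℤ) :
    conicMap (swap01 A) (swap01 P) (swap01 u) = swap01 (conicMap A P u) := by
  simp only [conicMap, swap01, ternForm, ternBilin, Prod.mk.injEq]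
  exact ⟨by ring, by ring, by ring⟩

/-- `conicMap` is equivariant under swapping coordinates `0, 2`. [folklore] -/
theorem conicMap_swap02 (A P u : ℤ × ℤ × ℤ) :
    conicMap (swap02 A) (swap02 P) (swap02 u) = swap02 (conicMap A P u) := by
  simp only [conicMap, swap02, ternForm, ternBilin, Prod.mk.injEq]
  exact ⟨by ring, by ring, by ring⟩

/-- `F` is invariant under the swaps. [folklore] -/
theorem ternForm_swap01 (A u : ℤ × ℤ × ℤ) : ternForm (swap01 A) (swap01 u) = ternForm A u := by
  simp only [ternForm, swap01]; ring

/-- `F` is invariant under the swaps. [folklore] -/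
theorem ternForm_swap02 (A u : ℤ × ℤ × ℤ) : ternForm (swap02 A) (swap02 u) = ternForm A u := by
  simp only [ternForm, swap02]; ring

/-- **`conicMap` respects congruences**: if `u ≡ u'` coordinatewise modulo `n` then
`conicMap A P u ≡ conicMap A P u'` coordinatewise modulo `n`. [folklore] -/
theorem conicMap_modEq {n : ℤ} (A P : ℤ × ℤ × ℤ) {u u' : ℤ × ℤ × ℤ} (h0 : u.1 ≡ u'.1 [ZMOD n])
    (h1 : u.2.1 ≡ u'.2.1 [ZMOD n]) (h2 : u.2.2 ≡ u'.2.2 [ZMOD n]) :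
    (conicMap A P u).1 ≡ (conicMap A P u').1 [ZMOD n] ∧
      (conicMap A P u).2.1 ≡ (conicMap A P u').2.1 [ZMOD n] ∧
      (conicMap A P u).2.2 ≡ (conicMap A P u').2.2 [ZMOD n] := by
  have hF : ternForm A u ≡ ternForm A u' [ZMOD n] := by
    unfold ternForm
    exact ((h0.pow 2).mul_left _).add ((h1.pow 2).mul_left _) |>.add ((h2.pow 2).mul_left _)
  have hL : ternBilin A u P ≡ ternBilin A u' P [ZMOD n] := by
    unfold ternBilin
    exact (((h0.mul_left _).mul_right _).add ((h1.mul_left _).mul_right _)).add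
      ((h2.mul_left _).mul_right _)
  simp only [conicMap]
  exact ⟨(hF.mul_right _).sub (((hL.mul_left _)).mul h0),
    (hF.mul_right _).sub (((hL.mul_left _)).mul h1),
    (hF.mul_right _).sub (((hL.mul_left _)).mul h2)⟩

/-! ## The chart reduction at a prime power: dropping coordinate `2` -/

/-- **Chart reduction, coordinate `2`.** If `γ = P₂` is invertible modulo `n` (`gcd(γ, n) = 1`),
then for every `u ∈ ℤ³` there are integers `k, s', t'` with `γ k ≡ u₂ (mod n)`,
`s' = u₀ − kα`, `t' = u₁ − kβ`, and then `conicMap A P u ≡ conicMap A P (s', t', 0)`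
coordinatewise modulo `n` (since `conicMap A P u = conicMap A P (u − kP)`). [folklore] -/
theorem chart2_reduction {A P : ℤ × ℤ × ℤ} (hP : ternForm A P = 0) {n : ℕ}
    (hγ : Nat.Coprime (P.2.2.natAbs) n) (u : ℤ × ℤ × ℤ) :
    ∃ k : ℤ, (n : ℤ) ∣ P.2.2 * k - u.2.2 ∧
      (conicMap A P u).1 ≡ (conicMap A P (u.1 - k * P.1, u.2.1 - k * P.2.1, 0)).1 [ZMOD n] ∧
      (conicMap A P u).2.1 ≡ (conicMap A P (u.1 - k * P.1, u.2.1 - k * P.2.1, 0)).2.1 [ZMOD n] ∧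
      (conicMap A P u).2.2 ≡ (conicMap A P (u.1 - k * P.1, u.2.1 - k * P.2.1, 0)).2.2 [ZMOD n] := by
  -- `γ y ≡ 1 (mod n)`
  obtain ⟨y, hy⟩ := Int.mod_coprime hγ
  have hy' : P.2.2 * (P.2.2.sign * y) ≡ 1 [ZMOD n] := by
    have e : P.2.2 * (P.2.2.sign * y) = (P.2.2.natAbs : ℤ) * y := by
      rw [← mul_assoc, mul_comm P.2.2, Int.sign_mul_self_eq_natAbs]
    rw [e]; exact hy
  refine ⟨P.2.2.sign * y * u.2.2, ?_, ?_⟩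
  · have h := (hy'.mul_right u.2.2)
    rw [one_mul] at h
    have := h.symm.dvd
    rw [show P.2.2 * (P.2.2.sign * y * u.2.2) = P.2.2 * (P.2.2.sign * y) * u.2.2 by ring]
    exact this
  · set k := P.2.2.sign * y * u.2.2 with hk
    have hw : conicMap A P u = conicMap A P (u + (-k) • P) := (conicMap_add_zsmul hP u (-k)).symm
    rw [hw]
    refine conicMap_modEq A P ?_ ?_ ?_
    · simp [neg_smul, sub_eq_add_neg]
    · simp [neg_smul, sub_eq_add_neg]
    · simp only [Prod.snd_add, Prod.smul_snd, smul_eq_mul, neg_mul]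
      -- `u₂ − kγ ≡ 0`
      have h := (hy'.mul_right u.2.2)
      rw [one_mul] at h
      have h2 : k * P.2.2 ≡ u.2.2 [ZMOD n] := by
        rw [hk, show P.2.2.sign * y * u.2.2 * P.2.2 = P.2.2 * (P.2.2.sign * y) * u.2.2 by ring]
        exact h
      have := (h2.neg.add_left u.2.2)
      simpa using this

/-- **Chart reduction, coordinate `0`** (through the swap `0 ↔ 2`): if `α = P₀` is invertible
modulo `n` then `conicMap A P u ≡ swap02 (conicMap (swap02 A) (swap02 P) (s', t', 0))` modulo
`n` with `s' = u₂ − kγ`, `t' = u₁ − kβ`, `α k ≡ u₀ (mod n)`. [folklore] -/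
theorem chart0_reduction {A P : ℤ × ℤ × ℤ} (hP : ternForm A P = 0) {n : ℕ}
    (hα : Nat.Coprime (P.1.natAbs) n) (u : ℤ × ℤ × ℤ) :
    ∃ k : ℤ, (n : ℤ) ∣ P.1 * k - u.1 ∧
      (conicMap A P u).1 ≡
        (conicMap (swap02 A) (swap02 P) (u.2.2 - k * P.2.2, u.2.1 - k * P.2.1, 0)).2.2 [ZMOD n] ∧
      (conicMap A P u).2.1 ≡
        (conicMap (swap02 A) (swap02 P) (u.2.2 - k * P.2.2, u.2.1 - k * P.2.1, 0)).2.1 [ZMOD n] ∧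
      (conicMap A P u).2.2 ≡
        (conicMap (swap02 A) (swap02 P) (u.2.2 - k * P.2.2, u.2.1 - k * P.2.1, 0)).1 [ZMOD n] := by
  have hP' : ternForm (swap02 A) (swap02 P) = 0 := by rw [ternForm_swap02]; exact hP
  obtain ⟨k, hk, h0, h1, h2⟩ := chart2_reduction hP' (by simpa [swap02] using hα) (swap02 u)
  refine ⟨k, by simpa [swap02] using hk, ?_, ?_, ?_⟩
  · have e := conicMap_swap02 A P u
    simp only [swap02] at h2 e ⊢
    rw [e] at h2
    exact h2
  · have e := conicMap_swap02 A P u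
    simp only [swap02] at h1 e ⊢
    rw [e] at h1
    exact h1
  · have e := conicMap_swap02 A P u
    simp only [swap02] at h0 e ⊢
    rw [e] at h0
    exact h0


/-! ## The standard local package at an odd prime `p ∥ A₀` -/

section PkgOdd

open Finset

variable {A P : ℤ × ℤ × ℤ} {p : ℕ}

/-- Reduction `ZMod (p²) → ZMod p`. [folklore] -/
def red (p : ℕ) : ZMod (p ^ 2) →+* ZMod p := ZMod.castHom (dvd_pow_self p two_ne_zero) (ZMod p)

/-- `red` of an integer. [folklore] -/
theorem red_intCast (p : ℕ) (z : ℤ) : red p (z : ZMod (p ^ 2)) = (z : ZMod p) := by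
  rw [red, ZMod.castHom_apply, ZMod.cast_intCast (dvd_pow_self p two_ne_zero)]

/-- `red p z = 0 ↔ p ∣ z` for an integer `z`. [folklore] -/
theorem red_intCast_eq_zero_iff (p : ℕ) (z : ℤ) : red p (z : ZMod (p ^ 2)) = 0 ↔ (p : ℤ) ∣ z := by
  rw [red_intCast, ZMod.intCast_zmod_eq_zero_iff_dvd]

/-- `x = 0` in `ℤ/p²` iff `p² ∣ x` for an integer `x`. [folklore] -/
theorem intCast_sq_eq_zero_iff (p : ℕ) (z : ℤ) : (z : ZMod (p ^ 2)) = 0 ↔ (p : ℤ) ^ 2 ∣ z := by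
  rw [ZMod.intCast_zmod_eq_zero_iff_dvd]; push_cast; rfl

open Classical in
/-- **The weight of the standard odd configuration** on `(ℤ/p²)²` (chart coordinates `(s, t)`):
`1` if `p ∤ t` and `p ∣ αt − 2βs` (content prime to `p`, condition `p ∣ X₀`); `p` if `p ∣ t`,
`p ∤ s` and `p² ∣ A₀αs + 2A₁βt` (content exactly `p`, condition `p² ∣ X₀`); `0` otherwise.
[folklore] -/
noncomputable def wOdd (A P : ℤ × ℤ × ℤ) (p : ℕ) (η : ZMod (p ^ 2) × ZMod (p ^ 2)) : ℕ :=
  if red p η.2 = 0 then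
    (if (¬red p η.1 = 0) ∧
      (A.1 : ZMod (p ^ 2)) * P.1 * η.1 + 2 * (A.2.1 : ZMod (p ^ 2)) * P.2.1 * η.2 = 0 then p else 0)
  else (if red p ((P.1 : ZMod (p ^ 2)) * η.2 - 2 * (P.2.1 : ZMod (p ^ 2)) * η.1) = 0 then 1 else 0)

/-- **Integer evaluation of `wOdd`.** [folklore] -/
theorem wOdd_intCast (A P : ℤ × ℤ × ℤ) (p : ℕ) (s t : ℤ) :
    wOdd A P p ((s : ZMod (p ^ 2)), (t : ZMod (p ^ 2))) =
      if (p : ℤ) ∣ t then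
        (if ¬(p : ℤ) ∣ s ∧ ((p : ℤ) ^ 2 ∣ A.1 * P.1 * s + 2 * A.2.1 * P.2.1 * t) then p else 0)
      else (if (p : ℤ) ∣ P.1 * t - 2 * P.2.1 * s then 1 else 0) := by
  classical
  unfold wOdd
  have h1 : red p (t : ZMod (p ^ 2)) = 0 ↔ (p : ℤ) ∣ t := red_intCast_eq_zero_iff p t
  have h2 : red p ((P.1 : ZMod (p ^ 2)) * t - 2 * (P.2.1 : ZMod (p ^ 2)) * s) = 0 ↔
      (p : ℤ) ∣ P.1 * t - 2 * P.2.1 * s := by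
    rw [← red_intCast_eq_zero_iff]; push_cast; rfl
  have h3 : red p (s : ZMod (p ^ 2)) = 0 ↔ (p : ℤ) ∣ s := red_intCast_eq_zero_iff p s
  have h4 : (A.1 : ZMod (p ^ 2)) * P.1 * s + 2 * (A.2.1 : ZMod (p ^ 2)) * P.2.1 * t = 0 ↔
      (p : ℤ) ^ 2 ∣ A.1 * P.1 * s + 2 * A.2.1 * P.2.1 * t := by
    rw [← intCast_sq_eq_zero_iff]; push_cast; rfl
  simp only [h1, h2, h3, h4]

/-- The possible values of `wOdd`. [folklore] -/
theorem wOdd_values (A P : ℤ × ℤ × ℤ) (p : ℕ) (η : ZMod (p ^ 2) × ZMod (p ^ 2)) :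
    wOdd A P p η = 0 ∨ wOdd A P p η = 1 ∨ wOdd A P p η = p := by
  classical
  unfold wOdd
  split_ifs <;> simp

/-- `wOdd` vanishes on the classes divisible by `p`. [folklore] -/
theorem wOdd_eq_zero_of_dvd (A P : ℤ × ℤ × ℤ) (p : ℕ) {s t : ℤ} (hs : (p : ℤ) ∣ s)
    (ht : (p : ℤ) ∣ t) : wOdd A P p ((s : ZMod (p ^ 2)), (t : ZMod (p ^ 2))) = 0 := by
  rw [wOdd_intCast, if_pos ht, if_neg (fun h => h.1 hs)]

/-- **(W1), odd standard package.** Let `p` be a prime with `v_p(A₀) = 1`, `p ∤ A₁`,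
`p ∤ β γ`, and `(s, t)` integers not both divisible by `p`; put `x = conicMap A P (s,t,0)` and
`w = wOdd A P p (s, t)`. If `w = 1` then `p ∤ x₂` and `p ∣ x₀`; if `w = p` then `p` divides all
coordinates of `x`, `p² ∤ x₁` and `p² ∣ x₀`. [folklore] -/
theorem wOdd_facts (hp : p.Prime) (hA0 : (p : ℤ) ∣ A.1) (hA0' : ¬((p : ℤ) ^ 2 ∣ A.1))
    (hA1 : ¬(p : ℤ) ∣ A.2.1) (hβ : ¬(p : ℤ) ∣ P.2.1) (hγ : ¬(p : ℤ) ∣ P.2.2) {s t : ℤ}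
    (hst : ¬((p : ℤ) ∣ s ∧ (p : ℤ) ∣ t)) :
    (wOdd A P p ((s : ZMod (p ^ 2)), (t : ZMod (p ^ 2))) = 1 →
      ¬(p : ℤ) ∣ (conicMap A P (s, t, 0)).2.2 ∧ (p : ℤ) ∣ (conicMap A P (s, t, 0)).1) ∧
    (wOdd A P p ((s : ZMod (p ^ 2)), (t : ZMod (p ^ 2))) = p →
      (p : ℤ) ∣ (conicMap A P (s, t, 0)).1 ∧ (p : ℤ) ∣ (conicMap A P (s, t, 0)).2.1 ∧
      (p : ℤ) ∣ (conicMap A P (s, t, 0)).2.2 ∧ ¬((p : ℤ) ^ 2 ∣ (conicMap A P (s, t, 0)).2.1) ∧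
      (p : ℤ) ^ 2 ∣ (conicMap A P (s, t, 0)).1) := by
  have hp1 : p ≠ 1 := hp.ne_one
  rw [wOdd_intCast]
  by_cases ht : (p : ℤ) ∣ t
  · rw [if_pos ht]
    have hs : ¬(p : ℤ) ∣ s := fun hs => hst ⟨hs, ht⟩
    by_cases hc : (p : ℤ) ^ 2 ∣ A.1 * P.1 * s + 2 * A.2.1 * P.2.1 * t
    · rw [if_pos ⟨hs, hc⟩]
      refine ⟨fun h => absurd h hp1, fun _ => ?_⟩
      obtain ⟨h0, h1, h2, h3⟩ := chart_dvd_of_dvd_t hp hA0 hA0' hβ ht hs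
      exact ⟨h0, h1, h2, h3, (chart_sq_dvd_X0_iff hp ht hs).2 hc⟩
    · rw [if_neg (fun h => hc h.2)]
      exact ⟨fun h => absurd h (by norm_num), fun h => absurd h.symm hp.ne_zero⟩
  · rw [if_neg ht]
    by_cases hc : (p : ℤ) ∣ P.1 * t - 2 * P.2.1 * s
    · rw [if_pos hc]
      refine ⟨fun _ => ⟨chart_not_dvd_X2 hp hA0 hA1 hγ ht, (chart_dvd_X0_iff hp hA0 hA1 ht).2 hc⟩,
        fun h => absurd h.symm hp1⟩
    · rw [if_neg hc]
      exact ⟨fun h => absurd h (by norm_num), fun h => absurd h.symm hp.ne_zero⟩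

/-! ### The sum of the odd weights -/

/-- The number of `w ∈ ℤ/p²` reducing to `0` modulo `p` is `p`. [folklore] -/
theorem card_filter_red_eq_zero (hp : p.Prime) [NeZero (p ^ 2)] [NeZero p] :
    (univ.filter fun w : ZMod (p ^ 2) => red p w = 0).card = p := by
  classical
  -- `red w = 0 ↔ p ∣ w.val`
  have hred : ∀ w : ZMod (p ^ 2), red p w = 0 ↔ p ∣ w.val := by
    intro w
    rw [red, ZMod.castHom_apply, ZMod.cast_eq_val, ZMod.natCast_eq_zero_iff]
  have hlt : ∀ i : ZMod p, p * i.val < p ^ 2 := fun i => by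
    rw [pow_two]; exact Nat.mul_lt_mul_of_pos_left (ZMod.val_lt i) hp.pos
  -- the multiples of `p` below `p²` are `p j`, `j < p`
  have himage : (univ.filter fun w : ZMod (p ^ 2) => red p w = 0) =
      (univ : Finset (ZMod p)).image fun j => ((p * j.val : ℕ) : ZMod (p ^ 2)) := by
    ext w
    simp only [mem_filter, mem_univ, true_and, mem_image, hred]
    constructor
    · rintro ⟨m, hm⟩
      have hm' : m < p := by
        have := ZMod.val_lt w
        rw [hm, pow_two] at this
        exact Nat.lt_of_mul_lt_mul_left this
      refine ⟨(m : ZMod p), ?_⟩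
      rw [ZMod.val_natCast_of_lt hm', ← hm, ZMod.natCast_zmod_val]
    · rintro ⟨j, rfl⟩
      rw [ZMod.val_natCast_of_lt (hlt j)]
      exact dvd_mul_right _ _
  rw [himage, card_image_of_injective, card_univ, ZMod.card]
  intro j j' h
  have h' := congr_arg ZMod.val h
  simp only [ZMod.val_natCast_of_lt (hlt j), ZMod.val_natCast_of_lt (hlt j')] at h'
  exact ZMod.val_injective p (Nat.eq_of_mul_eq_mul_left hp.pos h')

/-- The number of `w ∈ ℤ/p²` not reducing to `0` modulo `p` is `p (p − 1)`. [folklore] -/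
theorem card_filter_red_ne_zero (hp : p.Prime) [NeZero (p ^ 2)] [NeZero p] :
    (univ.filter fun w : ZMod (p ^ 2) => ¬red p w = 0).card = p * (p - 1) := by
  classical
  have h := Finset.card_filter_add_card_filter_not (s := (univ : Finset (ZMod (p ^ 2))))
    (fun w => red p w = 0)
  rw [card_filter_red_eq_zero hp, card_univ, ZMod.card] at h
  have e : p * (p - 1) + p = p ^ 2 := by
    rw [Nat.mul_sub_one, pow_two]; exact Nat.sub_add_cancel (Nat.le_mul_self p)
  omega

/-- An integer prime to `p` is a unit of `ℤ/p²`. [folklore] -/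
theorem isUnit_intCast_sq_of_not_dvd (hp : p.Prime) {z : ℤ} (hz : ¬(p : ℤ) ∣ z) :
    IsUnit (z : ZMod (p ^ 2)) := by
  have hcop : IsCoprime z ((p : ℤ) ^ 2) :=
    (((Prime.coprime_iff_not_dvd (Nat.prime_iff_prime_int.1 hp)).2 hz).symm).pow_right
  obtain ⟨a, b, hab⟩ := hcop
  have h : (z : ZMod (p ^ 2)) * a = 1 := by
    have := congr_arg (Int.cast : ℤ → ZMod (p ^ 2)) hab
    push_cast at this
    have hp0 : ((p : ZMod (p ^ 2))) ^ 2 = 0 := by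
      have := ZMod.natCast_self (p ^ 2)
      push_cast at this
      exact this
    rw [hp0, mul_zero, add_zero, mul_comm] at this
    exact this
  exact IsUnit.of_mul_eq_one _ h

/-- **(W2), odd standard package**: `Σ_{η ∈ (ℤ/p²)²} wOdd η = 2p²(p − 1)` for `p` an odd prime with
`p ∣ A₀`, `p ∤ A₁`, `p ∤ β`. [folklore] -/
theorem sum_wOdd (hp : p.Prime) [NeZero (p ^ 2)] [NeZero p] (hp2 : p ≠ 2) (hA0 : (p : ℤ) ∣ A.1)
    (hA1 : ¬(p : ℤ) ∣ A.2.1) (hβ : ¬(p : ℤ) ∣ P.2.1) :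
    ∑ η : ZMod (p ^ 2) × ZMod (p ^ 2), wOdd A P p η = 2 * p ^ 2 * (p - 1) := by
  classical
  have hp' : Prime (p : ℤ) := Nat.prime_iff_prime_int.1 hp
  have h2 : ¬(p : ℤ) ∣ 2 := by
    intro h
    have := Int.le_of_dvd (by norm_num) h
    have h3 : (p : ℤ) = 1 ∨ (p : ℤ) = 2 := by
      have := hp.two_le; omega
    rcases h3 with h3 | h3
    · exact hp.ne_one (by exact_mod_cast h3)
    · exact hp2 (by exact_mod_cast h3)
  -- units `2β` and `2A₁β`
  have hu1 : IsUnit ((2 * P.2.1 : ℤ) : ZMod (p ^ 2)) :=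
    isUnit_intCast_sq_of_not_dvd hp (fun h => (hp'.dvd_or_dvd h).elim h2 hβ)
  have hu2 : IsUnit ((2 * A.2.1 * P.2.1 : ℤ) : ZMod (p ^ 2)) :=
    isUnit_intCast_sq_of_not_dvd hp (fun h => by
      rcases hp'.dvd_or_dvd h with h | h
      · exact (hp'.dvd_or_dvd h).elim h2 hA1
      · exact hβ h)
  obtain ⟨u, hu⟩ := hu1
  obtain ⟨u', hu'⟩ := hu2
  set α' : ZMod (p ^ 2) := (P.1 : ZMod (p ^ 2)) with hα'
  set a0 : ZMod (p ^ 2) := ((A.1 * P.1 : ℤ) : ZMod (p ^ 2)) with ha0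
  -- pointwise decomposition `w = [C₁] + p [C₂]`
  set C1 : ZMod (p ^ 2) × ZMod (p ^ 2) → Prop := fun η =>
    ¬red p η.2 = 0 ∧ red p (α' * η.2 - (u : ZMod (p ^ 2)) * η.1) = 0 with hC1
  set C2 : ZMod (p ^ 2) × ZMod (p ^ 2) → Prop := fun η =>
    red p η.2 = 0 ∧ ¬red p η.1 = 0 ∧ a0 * η.1 + (u' : ZMod (p ^ 2)) * η.2 = 0 with hC2
  have hw : ∀ η, wOdd A P p η = (if C1 η then 1 else 0) + p * (if C2 η then 1 else 0) := by
    intro η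
    have e1 : (P.1 : ZMod (p ^ 2)) * η.2 - 2 * (P.2.1 : ZMod (p ^ 2)) * η.1 =
        α' * η.2 - (u : ZMod (p ^ 2)) * η.1 := by rw [hu]; push_cast; ring
    have e2 : (A.1 : ZMod (p ^ 2)) * P.1 * η.1 + 2 * (A.2.1 : ZMod (p ^ 2)) * P.2.1 * η.2 =
        a0 * η.1 + (u' : ZMod (p ^ 2)) * η.2 := by rw [ha0, hu']; push_cast; ring
    unfold wOdd
    rw [e1, e2]
    simp only [hC1, hC2]
    by_cases h : red p η.2 = 0
    · simp [h]
    · simp [h]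
  rw [Finset.sum_congr rfl fun η _ => hw η, sum_add_distrib, ← mul_sum, ← card_filter,
    ← card_filter]
  -- `#C₁ = p · p(p − 1)` through the bijection `(s, t) ↦ (α t − u s, t)`
  have hC1card : (univ.filter C1).card = p * (p * (p - 1)) := by
    have key1 : ∀ η : ZMod (p ^ 2) × ZMod (p ^ 2),
        (↑u⁻¹ : ZMod (p ^ 2)) * (α' * η.2 - (α' * η.2 - (u : ZMod (p ^ 2)) * η.1)) = η.1 := by
      intro η; rw [sub_sub_cancel, Units.inv_mul_cancel_left]
    have key2 : ∀ θ : ZMod (p ^ 2) × ZMod (p ^ 2),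
        α' * θ.2 - (u : ZMod (p ^ 2)) * ((↑u⁻¹ : ZMod (p ^ 2)) * (α' * θ.2 - θ.1)) = θ.1 := by
      intro θ; rw [Units.mul_inv_cancel_left, sub_sub_cancel]
    let Φ : ZMod (p ^ 2) × ZMod (p ^ 2) ≃ ZMod (p ^ 2) × ZMod (p ^ 2) :=
      { toFun := fun η => (α' * η.2 - (u : ZMod (p ^ 2)) * η.1, η.2)
        invFun := fun θ => ((↑u⁻¹ : ZMod (p ^ 2)) * (α' * θ.2 - θ.1), θ.2)
        left_inv := fun η => Prod.ext (key1 η) rfl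
        right_inv := fun θ => Prod.ext (key2 θ) rfl }
    have himg : (univ.filter C1).map Φ.toEmbedding =
        (univ.filter fun w : ZMod (p ^ 2) => red p w = 0) ×ˢ
          (univ.filter fun t : ZMod (p ^ 2) => ¬red p t = 0) := by
      ext θ
      simp only [mem_map_equiv, mem_filter, mem_univ, true_and, mem_product, hC1, Φ,
        Equiv.coe_fn_symm_mk, key2]
      exact and_comm
    rw [← card_map Φ.toEmbedding, himg, card_product, card_filter_red_eq_zero hp,
      card_filter_red_ne_zero hp]
  -- `#C₂ = p(p − 1)`: for each `s` with `red s ≠ 0` exactly one `t`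
  have hC2card : (univ.filter C2).card = p * (p - 1) := by
    have ha0red : red p a0 = 0 := by
      rw [ha0]; push_cast
      rw [map_mul, show red p (A.1 : ZMod (p ^ 2)) = 0 from (red_intCast_eq_zero_iff p A.1).2 hA0,
        zero_mul]
    set t₀ : ZMod (p ^ 2) → ZMod (p ^ 2) := fun s => -((↑u'⁻¹ : ZMod (p ^ 2)) * (a0 * s)) with ht₀
    have hsol : ∀ s t, a0 * s + (u' : ZMod (p ^ 2)) * t = 0 ↔ t = t₀ s := by
      intro s t
      constructor
      · intro h
        have h' : (u' : ZMod (p ^ 2)) * t = -(a0 * s) := by linear_combination h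
        calc t = (↑u'⁻¹ : ZMod (p ^ 2)) * ((u' : ZMod (p ^ 2)) * t) :=
              (Units.inv_mul_cancel_left u' t).symm
          _ = t₀ s := by rw [h', mul_neg]
      · rintro rfl
        show a0 * s + (u' : ZMod (p ^ 2)) * -((↑u'⁻¹ : ZMod (p ^ 2)) * (a0 * s)) = 0
        rw [mul_neg, Units.mul_inv_cancel_left, add_neg_cancel]
    have hred0 : ∀ s, red p (t₀ s) = 0 := by
      intro s
      show red p (-((↑u'⁻¹ : ZMod (p ^ 2)) * (a0 * s))) = 0
      rw [map_neg, map_mul, map_mul, ha0red, zero_mul, mul_zero, neg_zero]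
    have himg : (univ.filter C2) =
        (univ.filter fun s : ZMod (p ^ 2) => ¬red p s = 0).image fun s => (s, t₀ s) := by
      ext η
      simp only [mem_filter, mem_univ, true_and, mem_image, hC2]
      constructor
      · rintro ⟨_, h2, h3⟩
        exact ⟨η.1, h2, by rw [← (hsol η.1 η.2).1 h3]⟩
      · rintro ⟨s, hs, rfl⟩
        exact ⟨hred0 s, hs, (hsol s _).2 rfl⟩
    rw [himg, card_image_of_injective _ (fun s s' h => by simpa using congr_arg Prod.fst h),
      card_filter_red_ne_zero hp]
  rw [hC1card, hC2card]
  ring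

end PkgOdd


/-! ## The standard local packages at `p = 2` -/

section PkgTwo

open Finset

variable {A P : ℤ × ℤ × ℤ}

/-- `red 2 z = 0 ↔ 2 ∣ z`. [folklore] -/
theorem red_two_intCast_eq_zero_iff (z : ℤ) : red 2 (z : ZMod (2 ^ 2)) = 0 ↔ (2 : ℤ) ∣ z :=
  red_intCast_eq_zero_iff 2 z

/-- **Weight of the configuration `2 ∥ A₀`** (chart coordinates, assuming `α` even, which under
`2 ∥ A₀` is the solubility condition `8 ∣ A₁ + A₂`): `1` if `t` is odd (odd content, `2 ∣ X₀`),
`2` if `t` is even and `s` odd (content `2 ∥`, `4 ∣ X₀`), `0` on the even class. [folklore] -/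
def wTwoA (p : ℕ) (η : ZMod (p ^ 2) × ZMod (p ^ 2)) : ℕ :=
  if red p η.2 = 0 then (if red p η.1 = 0 then 0 else 2) else 1

/-- **Weight of the configuration `A₀A₁A₂` odd** (chart dropping an odd coordinate of `P`):
`2` if `s, t` are both odd (content `2 ∥`), `1` if exactly one is odd, `0` on the even class.
[folklore] -/
def wTwoB (p : ℕ) (η : ZMod (p ^ 2) × ZMod (p ^ 2)) : ℕ :=
  if red p η.2 = 0 then (if red p η.1 = 0 then 0 else 1) else (if red p η.1 = 0 then 1 else 2)

/-- `Σ wTwoA = 16`. [folklore] -/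
theorem sum_wTwoA : ∑ η : ZMod (2 ^ 2) × ZMod (2 ^ 2), wTwoA 2 η = 16 := by decide

/-- `Σ wTwoB = 16`. [folklore] -/
theorem sum_wTwoB : ∑ η : ZMod (2 ^ 2) × ZMod (2 ^ 2), wTwoB 2 η = 16 := by decide

/-- Integer evaluation of `wTwoA`. [folklore] -/
theorem wTwoA_intCast (s t : ℤ) : wTwoA 2 ((s : ZMod (2 ^ 2)), (t : ZMod (2 ^ 2))) =
    if (2 : ℤ) ∣ t then (if (2 : ℤ) ∣ s then 0 else 2) else 1 := by
  simp only [wTwoA, red_two_intCast_eq_zero_iff]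

/-- Integer evaluation of `wTwoB`. [folklore] -/
theorem wTwoB_intCast (s t : ℤ) : wTwoB 2 ((s : ZMod (2 ^ 2)), (t : ZMod (2 ^ 2))) =
    if (2 : ℤ) ∣ t then (if (2 : ℤ) ∣ s then 0 else 1) else (if (2 : ℤ) ∣ s then 1 else 2) := by
  simp only [wTwoB, red_two_intCast_eq_zero_iff]

/-- `wTwoA` vanishes on the even class. [folklore] -/
theorem wTwoA_eq_zero_of_dvd {s t : ℤ} (hs : (2 : ℤ) ∣ s) (ht : (2 : ℤ) ∣ t) :
    wTwoA 2 ((s : ZMod (2 ^ 2)), (t : ZMod (2 ^ 2))) = 0 := by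
  rw [wTwoA_intCast, if_pos ht, if_pos hs]

/-- `wTwoB` vanishes on the even class. [folklore] -/
theorem wTwoB_eq_zero_of_dvd {s t : ℤ} (hs : (2 : ℤ) ∣ s) (ht : (2 : ℤ) ∣ t) :
    wTwoB 2 ((s : ZMod (2 ^ 2)), (t : ZMod (2 ^ 2))) = 0 := by
  rw [wTwoB_intCast, if_pos ht, if_pos hs]

/-- Values of `wTwoA`. [folklore] -/
theorem wTwoA_values (p : ℕ) (η : ZMod (p ^ 2) × ZMod (p ^ 2)) :
    wTwoA p η = 0 ∨ wTwoA p η = 1 ∨ wTwoA p η = 2 := by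
  unfold wTwoA; split_ifs <;> simp

/-- Values of `wTwoB`. [folklore] -/
theorem wTwoB_values (p : ℕ) (η : ZMod (p ^ 2) × ZMod (p ^ 2)) :
    wTwoB p η = 0 ∨ wTwoB p η = 1 ∨ wTwoB p η = 2 := by
  unfold wTwoB; split_ifs <;> simp

/-- **(W1), configuration `2 ∥ A₀`.** Let `2 ∥ A₀`, `A₁, β, γ` odd and `α` even; for integers
`(s,t)` put `x = conicMap A P (s,t,0)`, `w = wTwoA (s,t)`. If `w = 1` then `x₂` is odd and
`2 ∣ x₀`; if `w = 2` then all `xᵢ` are even, `4 ∤ x₁` and `4 ∣ x₀`. [folklore] -/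
theorem wTwoA_facts (hA0 : (2 : ℤ) ∣ A.1) (hA0' : ¬(4 : ℤ) ∣ A.1) (hA1 : ¬(2 : ℤ) ∣ A.2.1)
    (hβ : ¬(2 : ℤ) ∣ P.2.1) (hγ : ¬(2 : ℤ) ∣ P.2.2) (hα : (2 : ℤ) ∣ P.1) (s t : ℤ) :
    (wTwoA 2 ((s : ZMod (2 ^ 2)), (t : ZMod (2 ^ 2))) = 1 →
      ¬(2 : ℤ) ∣ (conicMap A P (s, t, 0)).2.2 ∧ (2 : ℤ) ∣ (conicMap A P (s, t, 0)).1) ∧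
    (wTwoA 2 ((s : ZMod (2 ^ 2)), (t : ZMod (2 ^ 2))) = 2 →
      (2 : ℤ) ∣ (conicMap A P (s, t, 0)).1 ∧ (2 : ℤ) ∣ (conicMap A P (s, t, 0)).2.1 ∧
      (2 : ℤ) ∣ (conicMap A P (s, t, 0)).2.2 ∧ ¬((4 : ℤ) ∣ (conicMap A P (s, t, 0)).2.1) ∧
      (4 : ℤ) ∣ (conicMap A P (s, t, 0)).1) := by
  rw [wTwoA_intCast]
  by_cases ht : (2 : ℤ) ∣ t
  · rw [if_pos ht]
    by_cases hs : (2 : ℤ) ∣ s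
    · rw [if_pos hs]; simp
    · rw [if_neg hs]
      refine ⟨fun h => absurd h (by norm_num), fun _ => ?_⟩
      obtain ⟨h0, h1, h2, h3, h4⟩ := chart2_of_t_even hA0 hA0' hA1 hβ hγ hs ht
      exact ⟨h0, h1, h2, h3, h4.2 hα⟩
  · rw [if_neg ht]
    refine ⟨fun _ => ⟨chart2_X2_odd (hA0.mul_right s) hA1 hγ ht,
      (chart2_dvd_X0_iff hA0 hA1 ht).2 hα⟩, fun h => absurd h (by norm_num)⟩

/-- **(W1), configuration `A₀A₁A₂` odd.** Let `A₀, A₁, γ` be odd and exactly one of `α, β` even;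
for integers `(s,t)` put `x = conicMap A P (s,t,0)`, `w = wTwoB (s,t)`. If `w = 1` then `x₂` is
odd; if `w = 2` then all `xᵢ` are even and `x₀, x₁` are not both divisible by `4`. [folklore] -/
theorem wTwoB_facts (hA0 : ¬(2 : ℤ) ∣ A.1) (hA1 : ¬(2 : ℤ) ∣ A.2.1) (hγ : ¬(2 : ℤ) ∣ P.2.2)
    (hαβ : ((2 : ℤ) ∣ P.1 ∧ ¬(2 : ℤ) ∣ P.2.1) ∨ (¬(2 : ℤ) ∣ P.1 ∧ (2 : ℤ) ∣ P.2.1)) (s t : ℤ) :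
    (wTwoB 2 ((s : ZMod (2 ^ 2)), (t : ZMod (2 ^ 2))) = 1 →
      ¬(2 : ℤ) ∣ (conicMap A P (s, t, 0)).2.2) ∧
    (wTwoB 2 ((s : ZMod (2 ^ 2)), (t : ZMod (2 ^ 2))) = 2 →
      (2 : ℤ) ∣ (conicMap A P (s, t, 0)).1 ∧ (2 : ℤ) ∣ (conicMap A P (s, t, 0)).2.1 ∧
      (2 : ℤ) ∣ (conicMap A P (s, t, 0)).2.2 ∧
      ¬((4 : ℤ) ∣ (conicMap A P (s, t, 0)).1 ∧ (4 : ℤ) ∣ (conicMap A P (s, t, 0)).2.1)) := by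
  rw [wTwoB_intCast]
  by_cases ht : (2 : ℤ) ∣ t
  · rw [if_pos ht]
    by_cases hs : (2 : ℤ) ∣ s
    · rw [if_pos hs]; simp
    · rw [if_neg hs]
      refine ⟨fun _ => ?_, fun h => absurd h (by norm_num)⟩
      -- swap `s ↔ t`: the third coordinate is unchanged
      have e : (conicMap A P (s, t, 0)).2.2 = (conicMap (swap01 A) (swap01 P) (t, s, 0)).2.2 := by
        have := conicMap_swap01 A P (s, t, 0)
        simp only [swap01] at this ⊢
        rw [this]
      rw [e]
      exact chart2_X2_odd (A := swap01 A) (P := swap01 P) (by exact ht.mul_left _) hA0 hγ hs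
  · rw [if_neg ht]
    by_cases hs : (2 : ℤ) ∣ s
    · rw [if_pos hs]
      exact ⟨fun _ => chart2_X2_odd (hs.mul_left _) hA1 hγ ht, fun h => absurd h (by norm_num)⟩
    · rw [if_neg hs]
      refine ⟨fun h => absurd h (by norm_num), fun _ => chart2_of_s_t_odd hA0 hA1 hs ht hαβ⟩

end PkgTwo


/-! ## The chart transfers on `(ℤ/n)²` -/

section Transfer

variable {n : ℕ}

/-- `ū = η₁ ē₁ + η₂ ē₂ ∈ (ℤ/n)³`. [folklore] -/
def combZ (e₁ e₂ : ℤ × ℤ × ℤ) (n : ℕ) (η : ZMod n × ZMod n) : ZMod n × ZMod n × ZMod n :=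
  η.1 • (cast3 e₁ : ZMod n × ZMod n × ZMod n) + η.2 • cast3 e₂

/-- **Chart-`2` transfer** `η ↦ (ū₀ − kα, ū₁ − kβ)` with `k = ū₂ γ⁻¹` (the chart coordinates of
the class of `ū` modulo `P`, when `γ` is a unit). [folklore] -/
def transfer2 (P e₁ e₂ : ℤ × ℤ × ℤ) (n : ℕ) (η : ZMod n × ZMod n) : ZMod n × ZMod n :=
  ((combZ e₁ e₂ n η).1 - (combZ e₁ e₂ n η).2.2 * (P.2.2 : ZMod n)⁻¹ * P.1,
    (combZ e₁ e₂ n η).2.1 - (combZ e₁ e₂ n η).2.2 * (P.2.2 : ZMod n)⁻¹ * P.2.1)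

/-- **Chart-`0` transfer** `η ↦ (ū₂ − kγ, ū₁ − kβ)` with `k = ū₀ α⁻¹`. [folklore] -/
def transfer0 (P e₁ e₂ : ℤ × ℤ × ℤ) (n : ℕ) (η : ZMod n × ZMod n) : ZMod n × ZMod n :=
  ((combZ e₁ e₂ n η).2.2 - (combZ e₁ e₂ n η).1 * (P.1 : ZMod n)⁻¹ * P.2.2,
    (combZ e₁ e₂ n η).2.1 - (combZ e₁ e₂ n η).1 * (P.1 : ZMod n)⁻¹ * P.2.1)

/-- `combZ` of the cast of an integer vector is the cast of `v₁ e₁ + v₂ e₂`. [folklore] -/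
theorem combZ_intCast (e₁ e₂ : ℤ × ℤ × ℤ) (n : ℕ) (v : ℤ × ℤ) :
    combZ e₁ e₂ n ((v.1 : ZMod n), (v.2 : ZMod n)) =
      (cast3 (v.1 • e₁ + v.2 • e₂) : ZMod n × ZMod n × ZMod n) := by
  ext <;> simp [combZ, cast3, smul_eq_mul]

/-- `combZ` is additive/linear: `combZ (η − η') = combZ η − combZ η'`. [folklore] -/
theorem combZ_sub (e₁ e₂ : ℤ × ℤ × ℤ) (n : ℕ) (η η' : ZMod n × ZMod n) :
    combZ e₁ e₂ n (η - η') = combZ e₁ e₂ n η - combZ e₁ e₂ n η' := by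
  ext <;> simp [combZ, cast3, smul_eq_mul, sub_mul] <;> ring

/-- `transfer2` is linear: `T(η − η') = T η − T η'`. [folklore] -/
theorem transfer2_sub (P e₁ e₂ : ℤ × ℤ × ℤ) (n : ℕ) (η η' : ZMod n × ZMod n) :
    transfer2 P e₁ e₂ n (η - η') = transfer2 P e₁ e₂ n η - transfer2 P e₁ e₂ n η' := by
  ext <;> simp only [transfer2, combZ_sub, Prod.fst_sub, Prod.snd_sub] <;> ring

/-- `transfer0` is linear. [folklore] -/
theorem transfer0_sub (P e₁ e₂ : ℤ × ℤ × ℤ) (n : ℕ) (η η' : ZMod n × ZMod n) :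
    transfer0 P e₁ e₂ n (η - η') = transfer0 P e₁ e₂ n η - transfer0 P e₁ e₂ n η' := by
  ext <;> simp only [transfer0, combZ_sub, Prod.fst_sub, Prod.snd_sub] <;> ring

/-- **`transfer2` has trivial kernel** when `det(P,e₁,e₂) = 1` and `γ` is a unit mod `n`.
[folklore] -/
theorem transfer2_eq_zero {P e₁ e₂ : ℤ × ℤ × ℤ} (he : idet3 P e₁ e₂ = 1)
    (hγ : IsUnit (P.2.2 : ZMod n)) {η : ZMod n × ZMod n} (h : transfer2 P e₁ e₂ n η = 0) :
    η = 0 := by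
  set k : ZMod n := (combZ e₁ e₂ n η).2.2 * (P.2.2 : ZMod n)⁻¹ with hk
  have h1 : (combZ e₁ e₂ n η).1 = k * P.1 := by
    have := congr_arg Prod.fst h; simp only [transfer2, Prod.fst_zero] at this
    exact sub_eq_zero.1 this
  have h2 : (combZ e₁ e₂ n η).2.1 = k * P.2.1 := by
    have := congr_arg Prod.snd h; simp only [transfer2, Prod.snd_zero] at this
    exact sub_eq_zero.1 this
  have h3 : (combZ e₁ e₂ n η).2.2 = k * P.2.2 := by
    rw [hk, mul_assoc, ZMod.inv_mul_of_unit _ hγ, mul_one]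
  have hcomb : (-k) • (cast3 P : ZMod n × ZMod n × ZMod n) + η.1 • cast3 e₁ + η.2 • cast3 e₂ = 0 := by
    have e : η.1 • (cast3 e₁ : ZMod n × ZMod n × ZMod n) + η.2 • cast3 e₂ = k • cast3 P := by
      show combZ e₁ e₂ n η = k • cast3 P
      ext
      · simpa [cast3] using h1
      · simpa [cast3] using h2
      · simpa [cast3] using h3
    rw [add_assoc, e, neg_smul, neg_add_cancel]
  obtain ⟨-, h1, h2⟩ := comb_eq_zero_cast3 he hcomb
  exact Prod.ext h1 h2

/-- **`transfer0` has trivial kernel** when `det(P,e₁,e₂) = 1` and `α` is a unit mod `n`.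
[folklore] -/
theorem transfer0_eq_zero {P e₁ e₂ : ℤ × ℤ × ℤ} (he : idet3 P e₁ e₂ = 1)
    (hα : IsUnit (P.1 : ZMod n)) {η : ZMod n × ZMod n} (h : transfer0 P e₁ e₂ n η = 0) :
    η = 0 := by
  set k : ZMod n := (combZ e₁ e₂ n η).1 * (P.1 : ZMod n)⁻¹ with hk
  have h3 : (combZ e₁ e₂ n η).2.2 = k * P.2.2 := by
    have := congr_arg Prod.fst h; simp only [transfer0, Prod.fst_zero] at this
    exact sub_eq_zero.1 this
  have h2 : (combZ e₁ e₂ n η).2.1 = k * P.2.1 := by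
    have := congr_arg Prod.snd h; simp only [transfer0, Prod.snd_zero] at this
    exact sub_eq_zero.1 this
  have h1 : (combZ e₁ e₂ n η).1 = k * P.1 := by
    rw [hk, mul_assoc, ZMod.inv_mul_of_unit _ hα, mul_one]
  have hcomb : (-k) • (cast3 P : ZMod n × ZMod n × ZMod n) + η.1 • cast3 e₁ + η.2 • cast3 e₂ = 0 := by
    have e : η.1 • (cast3 e₁ : ZMod n × ZMod n × ZMod n) + η.2 • cast3 e₂ = k • cast3 P := by
      show combZ e₁ e₂ n η = k • cast3 P
      ext
      · simpa [cast3] using h1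
      · simpa [cast3] using h2
      · simpa [cast3] using h3
    rw [add_assoc, e, neg_smul, neg_add_cancel]
  obtain ⟨-, h1, h2⟩ := comb_eq_zero_cast3 he hcomb
  exact Prod.ext h1 h2

/-- `transfer2` is a bijection of `(ℤ/n)²` (`n ≥ 1`). [folklore] -/
theorem transfer2_bijective [NeZero n] {P e₁ e₂ : ℤ × ℤ × ℤ} (he : idet3 P e₁ e₂ = 1)
    (hγ : IsUnit (P.2.2 : ZMod n)) : Function.Bijective (transfer2 P e₁ e₂ n) := by
  refine (Finite.injective_iff_bijective).1 fun η η' h => ?_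
  have : transfer2 P e₁ e₂ n (η - η') = 0 := by rw [transfer2_sub, h, sub_self]
  exact sub_eq_zero.1 (transfer2_eq_zero he hγ this)

/-- `transfer0` is a bijection of `(ℤ/n)²` (`n ≥ 1`). [folklore] -/
theorem transfer0_bijective [NeZero n] {P e₁ e₂ : ℤ × ℤ × ℤ} (he : idet3 P e₁ e₂ = 1)
    (hα : IsUnit (P.1 : ZMod n)) : Function.Bijective (transfer0 P e₁ e₂ n) := by
  refine (Finite.injective_iff_bijective).1 fun η η' h => ?_
  have : transfer0 P e₁ e₂ n (η - η') = 0 := by rw [transfer0_sub, h, sub_self]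
  exact sub_eq_zero.1 (transfer0_eq_zero he hα this)

/-- **Integer compatibility of `transfer2`**: if `γ k ≡ u₂ (mod n)` for `u = v₁e₁ + v₂e₂` then
the casts of `(u₀ − kα, u₁ − kβ)` are `transfer2 (v̄)`. [folklore] -/
theorem transfer2_intCast {P e₁ e₂ : ℤ × ℤ × ℤ} (hγ : IsUnit (P.2.2 : ZMod n)) (v : ℤ × ℤ)
    {k : ℤ} (hk : (n : ℤ) ∣ P.2.2 * k - (v.1 • e₁ + v.2 • e₂).2.2) :
    ((((v.1 • e₁ + v.2 • e₂).1 - k * P.1 : ℤ) : ZMod n),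
      (((v.1 • e₁ + v.2 • e₂).2.1 - k * P.2.1 : ℤ) : ZMod n)) =
      transfer2 P e₁ e₂ n ((v.1 : ZMod n), (v.2 : ZMod n)) := by
  set u := v.1 • e₁ + v.2 • e₂ with hu
  have hk' : (k : ZMod n) = (u.2.2 : ZMod n) * (P.2.2 : ZMod n)⁻¹ := by
    have h0 : ((P.2.2 * k - u.2.2 : ℤ) : ZMod n) = 0 := (ZMod.intCast_zmod_eq_zero_iff_dvd _ n).2 hk
    push_cast at h0
    have h1 : (P.2.2 : ZMod n) * k = u.2.2 := sub_eq_zero.1 h0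
    calc (k : ZMod n) = (P.2.2 : ZMod n)⁻¹ * ((P.2.2 : ZMod n) * k) := by
          rw [← mul_assoc, ZMod.inv_mul_of_unit _ hγ, one_mul]
      _ = _ := by rw [h1, mul_comm]
  have hc := combZ_intCast e₁ e₂ n v
  rw [← hu] at hc
  simp only [transfer2, hc, cast3]
  push_cast
  rw [hk']

/-- **Integer compatibility of `transfer0`**: if `α k ≡ u₀ (mod n)` then the casts of
`(u₂ − kγ, u₁ − kβ)` are `transfer0 (v̄)`. [folklore] -/
theorem transfer0_intCast {P e₁ e₂ : ℤ × ℤ × ℤ} (hα : IsUnit (P.1 : ZMod n)) (v : ℤ × ℤ)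
    {k : ℤ} (hk : (n : ℤ) ∣ P.1 * k - (v.1 • e₁ + v.2 • e₂).1) :
    ((((v.1 • e₁ + v.2 • e₂).2.2 - k * P.2.2 : ℤ) : ZMod n),
      (((v.1 • e₁ + v.2 • e₂).2.1 - k * P.2.1 : ℤ) : ZMod n)) =
      transfer0 P e₁ e₂ n ((v.1 : ZMod n), (v.2 : ZMod n)) := by
  set u := v.1 • e₁ + v.2 • e₂ with hu
  have hk' : (k : ZMod n) = (u.1 : ZMod n) * (P.1 : ZMod n)⁻¹ := by
    have h0 : ((P.1 * k - u.1 : ℤ) : ZMod n) = 0 := (ZMod.intCast_zmod_eq_zero_iff_dvd _ n).2 hk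
    push_cast at h0
    have h1 : (P.1 : ZMod n) * k = u.1 := sub_eq_zero.1 h0
    calc (k : ZMod n) = (P.1 : ZMod n)⁻¹ * ((P.1 : ZMod n) * k) := by
          rw [← mul_assoc, ZMod.inv_mul_of_unit _ hα, one_mul]
      _ = _ := by rw [h1, mul_comm]
  have hc := combZ_intCast e₁ e₂ n v
  rw [← hu] at hc
  simp only [transfer0, hc, cast3]
  push_cast
  rw [hk']

/-- **Primitivity is preserved by the chart reduction** (chart `2`): for a prime `p`, if
`γ k ≡ u₂ (mod p)` and `p` divides both `u₀ − kα` and `u₁ − kβ` (`u = v₁e₁ + v₂e₂`,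
`det(P,e₁,e₂) = 1`), then `p ∣ v₁` and `p ∣ v₂`. [folklore] -/
theorem dvd_of_chart2_dvd {P e₁ e₂ : ℤ × ℤ × ℤ} (he : idet3 P e₁ e₂ = 1) {p : ℕ} (v : ℤ × ℤ)
    {k : ℤ} (hk : (p : ℤ) ∣ P.2.2 * k - (v.1 • e₁ + v.2 • e₂).2.2)
    (h1 : (p : ℤ) ∣ (v.1 • e₁ + v.2 • e₂).1 - k * P.1)
    (h2 : (p : ℤ) ∣ (v.1 • e₁ + v.2 • e₂).2.1 - k * P.2.1) : (p : ℤ) ∣ v.1 ∧ (p : ℤ) ∣ v.2 := by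
  set u := v.1 • e₁ + v.2 • e₂ with hu
  have hcomb : (-(k : ZMod p)) • (cast3 P : ZMod p × ZMod p × ZMod p) + (v.1 : ZMod p) • cast3 e₁ +
      (v.2 : ZMod p) • cast3 e₂ = 0 := by
    have hc := combZ_intCast e₁ e₂ p v
    rw [← hu] at hc
    have e : (v.1 : ZMod p) • (cast3 e₁ : ZMod p × ZMod p × ZMod p) + (v.2 : ZMod p) • cast3 e₂ =
        (k : ZMod p) • cast3 P := by
      show combZ e₁ e₂ p ((v.1 : ZMod p), (v.2 : ZMod p)) = (k : ZMod p) • cast3 P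
      rw [hc]
      have g1 := (ZMod.intCast_zmod_eq_zero_iff_dvd _ p).2 h1
      have g2 := (ZMod.intCast_zmod_eq_zero_iff_dvd _ p).2 h2
      have g3 := (ZMod.intCast_zmod_eq_zero_iff_dvd _ p).2 hk
      push_cast at g1 g2 g3
      ext <;> simp only [cast3, Prod.smul_fst, Prod.smul_snd, smul_eq_mul]
      · linear_combination g1
      · linear_combination g2
      · linear_combination -g3
    rw [add_assoc, e, neg_smul, neg_add_cancel]
  obtain ⟨-, g1, g2⟩ := comb_eq_zero_cast3 he hcomb
  exact ⟨(ZMod.intCast_zmod_eq_zero_iff_dvd _ p).1 g1, (ZMod.intCast_zmod_eq_zero_iff_dvd _ p).1 g2⟩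

/-- **Primitivity is preserved by the chart reduction** (chart `0`). [folklore] -/
theorem dvd_of_chart0_dvd {P e₁ e₂ : ℤ × ℤ × ℤ} (he : idet3 P e₁ e₂ = 1) {p : ℕ} (v : ℤ × ℤ)
    {k : ℤ} (hk : (p : ℤ) ∣ P.1 * k - (v.1 • e₁ + v.2 • e₂).1)
    (h1 : (p : ℤ) ∣ (v.1 • e₁ + v.2 • e₂).2.2 - k * P.2.2)
    (h2 : (p : ℤ) ∣ (v.1 • e₁ + v.2 • e₂).2.1 - k * P.2.1) : (p : ℤ) ∣ v.1 ∧ (p : ℤ) ∣ v.2 := by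
  set u := v.1 • e₁ + v.2 • e₂ with hu
  have hcomb : (-(k : ZMod p)) • (cast3 P : ZMod p × ZMod p × ZMod p) + (v.1 : ZMod p) • cast3 e₁ +
      (v.2 : ZMod p) • cast3 e₂ = 0 := by
    have hc := combZ_intCast e₁ e₂ p v
    rw [← hu] at hc
    have e : (v.1 : ZMod p) • (cast3 e₁ : ZMod p × ZMod p × ZMod p) + (v.2 : ZMod p) • cast3 e₂ =
        (k : ZMod p) • cast3 P := by
      show combZ e₁ e₂ p ((v.1 : ZMod p), (v.2 : ZMod p)) = (k : ZMod p) • cast3 P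
      rw [hc]
      have g1 := (ZMod.intCast_zmod_eq_zero_iff_dvd _ p).2 h1
      have g2 := (ZMod.intCast_zmod_eq_zero_iff_dvd _ p).2 h2
      have g3 := (ZMod.intCast_zmod_eq_zero_iff_dvd _ p).2 hk
      push_cast at g1 g2 g3
      ext <;> simp only [cast3, Prod.smul_fst, Prod.smul_snd, smul_eq_mul]
      · linear_combination -g3
      · linear_combination g2
      · linear_combination g1
    rw [add_assoc, e, neg_smul, neg_add_cancel]
  obtain ⟨-, g1, g2⟩ := comb_eq_zero_cast3 he hcomb
  exact ⟨(ZMod.intCast_zmod_eq_zero_iff_dvd _ p).1 g1, (ZMod.intCast_zmod_eq_zero_iff_dvd _ p).1 g2⟩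

end Transfer


/-! ## The local weights in the original coordinates -/

section LocalWeight

open Finset

/-- The signed coefficient vector `(a, b, −c)` of `aX² + bY² = cZ²`. [folklore] -/
def coeffs (a b c : ℕ) : ℤ × ℤ × ℤ := ((a : ℤ), (b : ℤ), -(c : ℤ))

open Classical in
/-- **The local weight at `p` of a class `η ∈ (ℤ/p²)²`** (original `(e₁,e₂)`-coordinates) for
the conic `aX² + bY² = cZ²` with base point `P` and unimodular completion `(e₁, e₂)`: the
standard package weight read in the chart adapted to `p` — drop coordinate `2` for `p ∣ ab` and
for `p = 2 ∤ abc` with `γ` odd, drop coordinate `0` for `p ∣ c` and for `p = 2 ∤ abc` with `γ`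
even; for `p ∣ b` the chart coordinates are swapped. (For `p ∤ 2abc` the value is irrelevant.)
[folklore] -/
noncomputable def localWeight (a b c : ℕ) (P e₁ e₂ : ℤ × ℤ × ℤ) (p : ℕ)
    (η : ZMod (p ^ 2) × ZMod (p ^ 2)) : ℕ :=
  if p ∣ a then
    (if p = 2 then wTwoA p (transfer2 P e₁ e₂ (p ^ 2) η)
      else wOdd (coeffs a b c) P p (transfer2 P e₁ e₂ (p ^ 2) η))
  else if p ∣ b then
    (if p = 2 then wTwoA p (transfer2 P e₁ e₂ (p ^ 2) η).swap
      else wOdd (swap01 (coeffs a b c)) (swap01 P) p (transfer2 P e₁ e₂ (p ^ 2) η).swap)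
  else if p ∣ c then
    (if p = 2 then wTwoA p (transfer0 P e₁ e₂ (p ^ 2) η)
      else wOdd (swap02 (coeffs a b c)) (swap02 P) p (transfer0 P e₁ e₂ (p ^ 2) η))
  else if (2 : ℤ) ∣ P.2.2 then wTwoB p (transfer0 P e₁ e₂ (p ^ 2) η)
  else wTwoB p (transfer2 P e₁ e₂ (p ^ 2) η)

/-- The local weight at a relevant prime (`p ∣ abc` or `p = 2`) takes the values `0, 1, p`.
[folklore] -/
theorem localWeight_values (a b c : ℕ) (P e₁ e₂ : ℤ × ℤ × ℤ) {p : ℕ}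
    (hrel : p ∣ a ∨ p ∣ b ∨ p ∣ c ∨ p = 2) (η : ZMod (p ^ 2) × ZMod (p ^ 2)) :
    localWeight a b c P e₁ e₂ p η = 0 ∨ localWeight a b c P e₁ e₂ p η = 1 ∨
      localWeight a b c P e₁ e₂ p η = p := by
  have hA : ∀ θ : ZMod (p ^ 2) × ZMod (p ^ 2), p = 2 →
      (wTwoA p θ = 0 ∨ wTwoA p θ = 1 ∨ wTwoA p θ = p) := by
    rintro θ rfl; exact wTwoA_values 2 θ
  have hB : ∀ θ : ZMod (p ^ 2) × ZMod (p ^ 2), p = 2 →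
      (wTwoB p θ = 0 ∨ wTwoB p θ = 1 ∨ wTwoB p θ = p) := by
    rintro θ rfl; exact wTwoB_values 2 θ
  unfold localWeight
  by_cases ha : p ∣ a
  · rw [if_pos ha]
    by_cases h2 : p = 2
    · rw [if_pos h2]; exact hA _ h2
    · rw [if_neg h2]; exact wOdd_values _ _ _ _
  rw [if_neg ha]
  by_cases hb : p ∣ b
  · rw [if_pos hb]
    by_cases h2 : p = 2
    · rw [if_pos h2]; exact hA _ h2
    · rw [if_neg h2]; exact wOdd_values _ _ _ _
  rw [if_neg hb]
  by_cases hc : p ∣ c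
  · rw [if_pos hc]
    by_cases h2 : p = 2
    · rw [if_pos h2]; exact hA _ h2
    · rw [if_neg h2]; exact wOdd_values _ _ _ _
  rw [if_neg hc]
  have h2 : p = 2 := by tauto
  split_ifs
  · exact hB _ h2
  · exact hB _ h2

/-! ### Units among the coordinates of `P` -/

/-- If `abc` is square-free, `aα² + bβ² = cγ²` with `gcd(α,β,γ) = 1` and `p ∣ a`, then
`p ∤ b`, `p ∤ c`, `p² ∤ a`, `p ∤ β`, `p ∤ γ`. [folklore] -/
theorem units_of_dvd_fst {a b c : ℕ} (hd : Squarefree (a * b * c)) {P : ℤ × ℤ × ℤ}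
    (hP : ternForm (coeffs a b c) P = 0) (hPc : content3 P = 1) {p : ℕ} (hp : p.Prime)
    (hpa : p ∣ a) :
    ¬(p : ℤ) ∣ (b : ℤ) ∧ ¬(p : ℤ) ∣ (c : ℤ) ∧ ¬((p : ℤ) ^ 2 ∣ (a : ℤ)) ∧ ¬(p : ℤ) ∣ P.2.1 ∧
      ¬(p : ℤ) ∣ P.2.2 := by
  have hp' : Prime (p : ℤ) := Nat.prime_iff_prime_int.1 hp
  have hsq : ∀ x y : ℕ, Squarefree (x * y) → p ∣ x → ¬p ∣ y := by
    intro x y hxy hx hy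
    have : p * p ∣ x * y := mul_dvd_mul hx hy
    exact hp.ne_one (by simpa using hxy p this)
  have hb : ¬p ∣ b := hsq a b (Squarefree.of_mul_left hd) hpa
  have hc : ¬p ∣ c := by
    have h1 : Squarefree (a * c) := by
      have : a * c ∣ a * b * c := ⟨b, by ring⟩
      exact hd.squarefree_of_dvd this
    exact hsq a c h1 hpa
  have ha2 : ¬p ^ 2 ∣ a := by
    intro h
    have hsa : Squarefree a := Squarefree.of_mul_left (Squarefree.of_mul_left hd)
    rw [pow_two] at h
    exact hp.ne_one (by simpa using hsa p h)
  have hb' : ¬(p : ℤ) ∣ (b : ℤ) := fun h => hb (Int.natCast_dvd_natCast.1 h)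
  have hc' : ¬(p : ℤ) ∣ (c : ℤ) := fun h => hc (Int.natCast_dvd_natCast.1 h)
  have ha2' : ¬((p : ℤ) ^ 2 ∣ (a : ℤ)) := fun h => ha2 (by exact_mod_cast h)
  have hpa' : (p : ℤ) ∣ (a : ℤ) := Int.natCast_dvd_natCast.2 hpa
  refine ⟨hb', hc', ha2', ?_, ?_⟩
  · -- `p ∣ β`: then `p ∣ cγ²`, so `p ∣ γ`, so `p² ∣ aα²`, so `p ∣ α`: contradiction
    intro hβ
    simp only [ternForm, coeffs] at hP
    have h1 : (p : ℤ) ∣ (c : ℤ) * P.2.2 ^ 2 := by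
      have : (c : ℤ) * P.2.2 ^ 2 = (a : ℤ) * P.1 ^ 2 + (b : ℤ) * P.2.1 ^ 2 := by linear_combination -hP
      rw [this]
      exact (hpa'.mul_right _).add ((hβ.pow two_ne_zero).mul_left _ |>.trans (by rfl))
    have hγ : (p : ℤ) ∣ P.2.2 := by
      rcases hp'.dvd_or_dvd h1 with h | h
      · exact absurd h hc'
      · exact hp'.dvd_of_dvd_pow h
    have h2 : (p : ℤ) ^ 2 ∣ (a : ℤ) * P.1 ^ 2 := by
      have : (a : ℤ) * P.1 ^ 2 = (c : ℤ) * P.2.2 ^ 2 - (b : ℤ) * P.2.1 ^ 2 := by linear_combination hP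
      rw [this, pow_two]
      exact Int.dvd_sub ((mul_dvd_mul hγ hγ).mul_left _ |>.trans (by rw [pow_two]))
        ((mul_dvd_mul hβ hβ).mul_left _ |>.trans (by rw [pow_two]))
    have hα : (p : ℤ) ∣ P.1 := by
      -- `v_p(a) = 1`
      obtain ⟨a', ha'⟩ := hpa'
      rw [ha', pow_two, mul_assoc] at h2
      have h3 : (p : ℤ) ∣ a' * P.1 ^ 2 := (mul_dvd_mul_iff_left (by exact_mod_cast hp.ne_zero)).1 h2
      rcases hp'.dvd_or_dvd h3 with h | h
      · exact absurd (by rw [ha', pow_two]; exact mul_dvd_mul_left _ h) ha2'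
      · exact hp'.dvd_of_dvd_pow h
    have : p ∣ content3 P := dvd_content3 hα hβ hγ
    rw [hPc] at this
    exact hp.ne_one (Nat.dvd_one.1 this)
  · -- `p ∣ γ`: then `p ∣ bβ²`, so `p ∣ β`: reduce to the previous case's contradiction
    intro hγ
    simp only [ternForm, coeffs] at hP
    have h1 : (p : ℤ) ∣ (b : ℤ) * P.2.1 ^ 2 := by
      have : (b : ℤ) * P.2.1 ^ 2 = (c : ℤ) * P.2.2 ^ 2 - (a : ℤ) * P.1 ^ 2 := by linear_combination hP
      rw [this]
      exact Int.dvd_sub ((hγ.pow two_ne_zero).mul_left _) (hpa'.mul_right _)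
    have hβ : (p : ℤ) ∣ P.2.1 := by
      rcases hp'.dvd_or_dvd h1 with h | h
      · exact absurd h hb'
      · exact hp'.dvd_of_dvd_pow h
    have h2 : (p : ℤ) ^ 2 ∣ (a : ℤ) * P.1 ^ 2 := by
      have : (a : ℤ) * P.1 ^ 2 = (c : ℤ) * P.2.2 ^ 2 - (b : ℤ) * P.2.1 ^ 2 := by linear_combination hP
      rw [this, pow_two]
      exact Int.dvd_sub ((mul_dvd_mul hγ hγ).mul_left _ |>.trans (by rw [pow_two]))
        ((mul_dvd_mul hβ hβ).mul_left _ |>.trans (by rw [pow_two]))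
    have hα : (p : ℤ) ∣ P.1 := by
      obtain ⟨a', ha'⟩ := hpa'
      rw [ha', pow_two, mul_assoc] at h2
      have h3 : (p : ℤ) ∣ a' * P.1 ^ 2 := (mul_dvd_mul_iff_left (by exact_mod_cast hp.ne_zero)).1 h2
      rcases hp'.dvd_or_dvd h3 with h | h
      · exact absurd (by rw [ha', pow_two]; exact mul_dvd_mul_left _ h) ha2'
      · exact hp'.dvd_of_dvd_pow h
    have : p ∣ content3 P := dvd_content3 hα hβ hγ
    rw [hPc] at this
    exact hp.ne_one (Nat.dvd_one.1 this)

end LocalWeight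


section LocalWeightFacts

open Finset

/-- `content3` is invariant under `swap01`. [folklore] -/
theorem content3_swap01 (P : ℤ × ℤ × ℤ) : content3 (swap01 P) = content3 P := by
  simp only [content3, swap01]
  rw [← Int.gcd_assoc, Int.gcd_comm P.2.1 P.1, Int.gcd_assoc]

/-- `content3` is invariant under `swap02`. [folklore] -/
theorem content3_swap02 (P : ℤ × ℤ × ℤ) : content3 (swap02 P) = content3 P := by
  simp only [content3, swap02]
  rw [← Int.gcd_assoc, Int.gcd_comm (↑(Int.gcd P.2.2 P.2.1)) P.1, Int.gcd_comm P.2.2 P.2.1]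

/-- If `abc` is square-free, `aα² + bβ² = cγ²` with `gcd(α,β,γ) = 1` and `p ∣ c`, then
`p ∤ a`, `p ∤ b`, `p² ∤ c`, `p ∤ α`, `p ∤ β`. [folklore] -/
theorem units_of_dvd_thd {a b c : ℕ} (hd : Squarefree (a * b * c)) {P : ℤ × ℤ × ℤ}
    (hP : ternForm (coeffs a b c) P = 0) (hPc : content3 P = 1) {p : ℕ} (hp : p.Prime)
    (hpc : p ∣ c) :
    ¬(p : ℤ) ∣ (a : ℤ) ∧ ¬(p : ℤ) ∣ (b : ℤ) ∧ ¬((p : ℤ) ^ 2 ∣ (c : ℤ)) ∧ ¬(p : ℤ) ∣ P.1 ∧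
      ¬(p : ℤ) ∣ P.2.1 := by
  have hp' : Prime (p : ℤ) := Nat.prime_iff_prime_int.1 hp
  have hsq : ∀ x y : ℕ, Squarefree (x * y) → p ∣ x → ¬p ∣ y := by
    intro x y hxy hx hy
    have : p * p ∣ x * y := mul_dvd_mul hx hy
    exact hp.ne_one (by simpa using hxy p this)
  have hca : Squarefree (c * a) := hd.squarefree_of_dvd ⟨b, by ring⟩
  have hcb : Squarefree (c * b) := hd.squarefree_of_dvd ⟨a, by ring⟩
  have ha : ¬p ∣ a := hsq c a hca hpc
  have hb : ¬p ∣ b := hsq c b hcb hpc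
  have hc2 : ¬p ^ 2 ∣ c := by
    intro h
    have hsc : Squarefree c := Squarefree.of_mul_right hd
    rw [pow_two] at h
    exact hp.ne_one (by simpa using hsc p h)
  have ha' : ¬(p : ℤ) ∣ (a : ℤ) := fun h => ha (Int.natCast_dvd_natCast.1 h)
  have hb' : ¬(p : ℤ) ∣ (b : ℤ) := fun h => hb (Int.natCast_dvd_natCast.1 h)
  have hc2' : ¬((p : ℤ) ^ 2 ∣ (c : ℤ)) := fun h => hc2 (by exact_mod_cast h)
  have hpc' : (p : ℤ) ∣ (c : ℤ) := Int.natCast_dvd_natCast.2 hpc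
  simp only [ternForm, coeffs] at hP
  -- if `p` divides one of `α, β` it divides the other, then `p² ∣ cγ²`, `p ∣ γ`
  have key : (p : ℤ) ∣ P.1 → (p : ℤ) ∣ P.2.1 → False := by
    intro hα hβ
    have h2 : (p : ℤ) ^ 2 ∣ (c : ℤ) * P.2.2 ^ 2 := by
      have : (c : ℤ) * P.2.2 ^ 2 = (a : ℤ) * P.1 ^ 2 + (b : ℤ) * P.2.1 ^ 2 := by linear_combination -hP
      rw [this, pow_two]
      exact Int.dvd_add ((mul_dvd_mul hα hα).mul_left _ |>.trans (by rw [pow_two]))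
        ((mul_dvd_mul hβ hβ).mul_left _ |>.trans (by rw [pow_two]))
    have hγ : (p : ℤ) ∣ P.2.2 := by
      obtain ⟨c', hc'⟩ := hpc'
      rw [hc', pow_two, mul_assoc] at h2
      have h3 : (p : ℤ) ∣ c' * P.2.2 ^ 2 := (mul_dvd_mul_iff_left (by exact_mod_cast hp.ne_zero)).1 h2
      rcases hp'.dvd_or_dvd h3 with h | h
      · exact absurd (by rw [hc', pow_two]; exact mul_dvd_mul_left _ h) hc2'
      · exact hp'.dvd_of_dvd_pow h
    have : p ∣ content3 P := dvd_content3 hα hβ hγ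
    rw [hPc] at this
    exact hp.ne_one (Nat.dvd_one.1 this)
  refine ⟨ha', hb', hc2', fun hα => ?_, fun hβ => ?_⟩
  · have h1 : (p : ℤ) ∣ (b : ℤ) * P.2.1 ^ 2 := by
      have : (b : ℤ) * P.2.1 ^ 2 = (c : ℤ) * P.2.2 ^ 2 - (a : ℤ) * P.1 ^ 2 := by linear_combination hP
      rw [this]
      exact Int.dvd_sub (hpc'.mul_right _) ((hα.pow two_ne_zero).mul_left _)
    have hβ : (p : ℤ) ∣ P.2.1 := by
      rcases hp'.dvd_or_dvd h1 with h | h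
      · exact absurd h hb'
      · exact hp'.dvd_of_dvd_pow h
    exact key hα hβ
  · have h1 : (p : ℤ) ∣ (a : ℤ) * P.1 ^ 2 := by
      have : (a : ℤ) * P.1 ^ 2 = (c : ℤ) * P.2.2 ^ 2 - (b : ℤ) * P.2.1 ^ 2 := by linear_combination hP
      rw [this]
      exact Int.dvd_sub (hpc'.mul_right _) ((hβ.pow two_ne_zero).mul_left _)
    have hα : (p : ℤ) ∣ P.1 := by
      rcases hp'.dvd_or_dvd h1 with h | h
      · exact absurd h ha'
      · exact hp'.dvd_of_dvd_pow h
    exact key hα hβ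

/-- **Parities of `P` when `abc` is odd**: `aα² + bβ² = cγ²`, `gcd(α,β,γ) = 1` force exactly one
of `α, β, γ` to be even. [folklore] -/
theorem parities_of_odd {a b c : ℕ} (ha : ¬(2 : ℤ) ∣ (a : ℤ)) (hb : ¬(2 : ℤ) ∣ (b : ℤ))
    (hc : ¬(2 : ℤ) ∣ (c : ℤ)) {P : ℤ × ℤ × ℤ} (hP : ternForm (coeffs a b c) P = 0)
    (hPc : content3 P = 1) :
    (¬(2 : ℤ) ∣ P.2.2 → ((2 : ℤ) ∣ P.1 ∧ ¬(2 : ℤ) ∣ P.2.1) ∨ (¬(2 : ℤ) ∣ P.1 ∧ (2 : ℤ) ∣ P.2.1)) ∧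
      ((2 : ℤ) ∣ P.2.2 → ¬(2 : ℤ) ∣ P.1 ∧ ¬(2 : ℤ) ∣ P.2.1) := by
  have core : ∀ x y z al be ga : ZMod 2, x = 1 → y = 1 → z = 1 →
      x * al ^ 2 + y * be ^ 2 + -z * ga ^ 2 = 0 → ¬(al = 0 ∧ be = 0 ∧ ga = 0) →
      ((¬ga = 0 → (al = 0 ∧ ¬be = 0) ∨ (¬al = 0 ∧ be = 0)) ∧ (ga = 0 → ¬al = 0 ∧ ¬be = 0)) := by
    decide
  have h2 : ∀ z : ℤ, (2 : ℤ) ∣ z ↔ (z : ZMod 2) = 0 := fun z => by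
    rw [show (2 : ℤ) = ((2 : ℕ) : ℤ) by norm_num, ZMod.intCast_zmod_eq_zero_iff_dvd]
  have hodd : ∀ z : ℤ, ¬(2 : ℤ) ∣ z → (z : ZMod 2) = 1 := by
    intro z hz
    rw [h2] at hz
    have : ∀ w : ZMod 2, ¬w = 0 → w = 1 := by decide
    exact this _ hz
  have hP' : ((a : ℤ) : ZMod 2) * (P.1 : ZMod 2) ^ 2 + ((b : ℤ) : ZMod 2) * (P.2.1 : ZMod 2) ^ 2 +
      -((c : ℤ) : ZMod 2) * (P.2.2 : ZMod 2) ^ 2 = 0 := by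
    have := congr_arg (Int.cast : ℤ → ZMod 2) hP
    simp only [ternForm, coeffs] at this
    push_cast at this ⊢
    linear_combination this
  have hprim : ¬((P.1 : ZMod 2) = 0 ∧ (P.2.1 : ZMod 2) = 0 ∧ (P.2.2 : ZMod 2) = 0) := by
    rintro ⟨g1, g2, g3⟩
    rw [← h2] at g1 g2 g3
    have : 2 ∣ content3 P := dvd_content3 g1 g2 g3
    rw [hPc] at this
    omega
  obtain ⟨c1, c2⟩ := core _ _ _ _ _ _ (hodd _ ha) (hodd _ hb) (hodd _ hc) hP' hprim
  simp only [h2]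
  exact ⟨c1, c2⟩

/-- Divisibility transfers along a congruence. [folklore] -/
theorem dvd_iff_of_modEq {n d x y : ℤ} (h : x ≡ y [ZMOD n]) (hd : d ∣ n) : d ∣ x ↔ d ∣ y := by
  have h1 : d ∣ y - x := hd.trans h.dvd
  constructor
  · intro hx; have := Int.dvd_add hx h1; rwa [add_sub_cancel] at this
  · intro hy; have := Int.dvd_sub hy h1; rwa [sub_sub_cancel] at this

/-- `p` and `p²` divide `(p²:ℕ)` as integers. [folklore] -/
theorem natCast_pow_two_dvd (p : ℕ) : ((p : ℤ) ∣ ((p ^ 2 : ℕ) : ℤ)) ∧ ((p : ℤ) ^ 2 ∣ ((p ^ 2 : ℕ) : ℤ)) :=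
  ⟨⟨p, by push_cast; ring⟩, ⟨1, by push_cast; ring⟩⟩

/-- Coprimality of `|z|` with `p²` from `p ∤ z`. [folklore] -/
theorem coprime_natAbs_sq_of_not_dvd {p : ℕ} (hp : p.Prime) {z : ℤ} (hz : ¬(p : ℤ) ∣ z) :
    Nat.Coprime z.natAbs (p ^ 2) := by
  refine Nat.Coprime.pow_right 2 ?_
  rw [Nat.coprime_comm, hp.coprime_iff_not_dvd]
  exact fun h => hz (Int.natCast_dvd.2 h)

variable {a b c : ℕ} {P e₁ e₂ : ℤ × ℤ × ℤ}

/-- **(G1) at a prime `p ∣ a`.** For a primitive `v`, with `X = conicMap (a,b,−c) P (v₁e₁+v₂e₂)`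
and `w` the local weight of the class of `v`: `w = 1 ⟹ p ∤ X₂ ∧ p ∣ X₀`;
`w = p ⟹ p ∣ X₀, X₁, X₂ ∧ p² ∤ X₁ ∧ p² ∣ X₀`. (At `p = 2` the solubility condition
`8 ∣ b − c` is assumed.) [folklore] -/
theorem localWeight_facts_a (hd : Squarefree (a * b * c)) (hP : ternForm (coeffs a b c) P = 0)
    (hPc : content3 P = 1) (he : idet3 P e₁ e₂ = 1) {p : ℕ} (hp : p.Prime) (hpa : p ∣ a)
    (h8 : p = 2 → (8 : ℤ) ∣ (b : ℤ) - c) {v : ℤ × ℤ} (hv : Int.gcd v.1 v.2 = 1) :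
    (localWeight a b c P e₁ e₂ p ((v.1 : ZMod (p ^ 2)), (v.2 : ZMod (p ^ 2))) = 1 →
      ¬(p : ℤ) ∣ (conicMap (coeffs a b c) P (v.1 • e₁ + v.2 • e₂)).2.2 ∧
        (p : ℤ) ∣ (conicMap (coeffs a b c) P (v.1 • e₁ + v.2 • e₂)).1) ∧
    (localWeight a b c P e₁ e₂ p ((v.1 : ZMod (p ^ 2)), (v.2 : ZMod (p ^ 2))) = p →
      (p : ℤ) ∣ (conicMap (coeffs a b c) P (v.1 • e₁ + v.2 • e₂)).1 ∧
      (p : ℤ) ∣ (conicMap (coeffs a b c) P (v.1 • e₁ + v.2 • e₂)).2.1 ∧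
      (p : ℤ) ∣ (conicMap (coeffs a b c) P (v.1 • e₁ + v.2 • e₂)).2.2 ∧
      ¬((p : ℤ) ^ 2 ∣ (conicMap (coeffs a b c) P (v.1 • e₁ + v.2 • e₂)).2.1) ∧
      (p : ℤ) ^ 2 ∣ (conicMap (coeffs a b c) P (v.1 • e₁ + v.2 • e₂)).1) := by
  obtain ⟨hb, _, ha2, hβ, hγ⟩ := units_of_dvd_fst hd hP hPc hp hpa
  have hpa' : (p : ℤ) ∣ (a : ℤ) := Int.natCast_dvd_natCast.2 hpa
  haveI : NeZero (p ^ 2) := ⟨pow_ne_zero 2 hp.ne_zero⟩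
  have hγu : IsUnit (P.2.2 : ZMod (p ^ 2)) := isUnit_intCast_sq_of_not_dvd hp hγ
  set u := v.1 • e₁ + v.2 • e₂ with hu
  obtain ⟨k, hk, h0, h1, h2⟩ := chart2_reduction hP (coprime_natAbs_sq_of_not_dvd hp hγ) u
  obtain ⟨hdp, hdp2⟩ := natCast_pow_two_dvd p
  set s' := u.1 - k * P.1 with hs'
  set t' := u.2.1 - k * P.2.1 with ht'
  have hT : ((s' : ZMod (p ^ 2)), (t' : ZMod (p ^ 2))) =
      transfer2 P e₁ e₂ (p ^ 2) ((v.1 : ZMod (p ^ 2)), (v.2 : ZMod (p ^ 2))) :=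
    transfer2_intCast hγu v hk
  have hst : ¬((p : ℤ) ∣ s' ∧ (p : ℤ) ∣ t') := by
    rintro ⟨h1', h2'⟩
    obtain ⟨d1, d2⟩ := dvd_of_chart2_dvd he v (hdp.trans hk) h1' h2'
    have : p ∣ Int.gcd v.1 v.2 := Int.dvd_gcd d1 d2
    rw [hv] at this
    exact hp.ne_one (Nat.dvd_one.1 this)
  unfold localWeight
  rw [if_pos hpa]
  by_cases hp2 : p = 2
  · subst hp2
    rw [if_pos rfl, ← hT]
    have h4 : ¬(4 : ℤ) ∣ (a : ℤ) := by simpa using ha2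
    have h2a : (2 : ℤ) ∣ ((coeffs a b c).1) := hpa'
    have hα : (2 : ℤ) ∣ P.1 :=
      (two_dvd_fst_iff_eight_dvd (A := coeffs a b c) h2a h4 hb (by simpa [coeffs] using
        (units_of_dvd_fst hd hP hPc Nat.prime_two hpa).2.1) hβ hγ hP).2 (by
          simpa [coeffs, sub_eq_add_neg] using h8 rfl)
    obtain ⟨f1, f2⟩ := wTwoA_facts (A := coeffs a b c) h2a h4 hb hβ hγ hα s' t'
    constructor
    · intro hw
      obtain ⟨g1, g2⟩ := f1 hw
      exact ⟨fun h => g1 ((dvd_iff_of_modEq h2 hdp).1 h), (dvd_iff_of_modEq h0 hdp).2 g2⟩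
    · intro hw
      obtain ⟨g1, g2, g3, g4, g5⟩ := f2 hw
      rw [show (4 : ℤ) = ((2 : ℕ) : ℤ) ^ 2 by norm_num] at g4 g5
      exact ⟨(dvd_iff_of_modEq h0 hdp).2 g1, (dvd_iff_of_modEq h1 hdp).2 g2,
        (dvd_iff_of_modEq h2 hdp).2 g3, fun h => g4 ((dvd_iff_of_modEq h1 hdp2).1 h),
        (dvd_iff_of_modEq h0 hdp2).2 g5⟩
  · rw [if_neg hp2, ← hT]
    obtain ⟨f1, f2⟩ := wOdd_facts (A := coeffs a b c) hp hpa' ha2 hb hβ hγ hst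
    constructor
    · intro hw
      obtain ⟨g1, g2⟩ := f1 hw
      exact ⟨fun h => g1 ((dvd_iff_of_modEq h2 hdp).1 h), (dvd_iff_of_modEq h0 hdp).2 g2⟩
    · intro hw
      obtain ⟨g1, g2, g3, g4, g5⟩ := f2 hw
      exact ⟨(dvd_iff_of_modEq h0 hdp).2 g1, (dvd_iff_of_modEq h1 hdp).2 g2,
        (dvd_iff_of_modEq h2 hdp).2 g3, fun h => g4 ((dvd_iff_of_modEq h1 hdp2).1 h),
        (dvd_iff_of_modEq h0 hdp2).2 g5⟩

end LocalWeightFacts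

end Literature.NumberTheory.DiophantineGeometry
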